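import Mathlib
import HarnessLib

/-!
# Polar (Löwdin) orthonormalisation of a nearly orthonormal frame, with Loewner-order bounds

Topic `LinearAlgebra/Matrix`; namespace `Literature.LinearAlgebra.Matrix.PolarOrthonormalization`.
Everything here is a DEFINITION with a body or a PROVED theorem; no named fact is introduced.
Scalars: any `RCLike 𝕜` (so `ℝ` and `ℂ`), Loewner order `open scoped MatrixOrder`.

For `V ∈ M_{m,n}(𝕜)` of full column rank the polar decomposition `V = U Q`, `Q = (VᴴV)^{1/2}`,
`U = V (VᴴV)^{-1/2}`, has `U` with ORTHONORMAL COLUMNS, `UᴴU = 1` (Horn–Johnson, *Matrix Analysis*,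
Thm. 7.3.1 (c)); equivalently, for a finite family of square matrices `A_s` with Gram matrix
`G = Σ_s A_sᴴ A_s ≻ 0` the family `Ã_s = A_s G^{-1/2}` is an exact isometry, `Σ_s Ã_sᴴ Ã_s = 1`
(Löwdin's "symmetric orthonormalisation"). This file provides, inside Mathlib's continuous
functional calculus of self-adjoint matrices (`Matrix.IsHermitian.instContinuousFunctionalCalculus`):

* `invSqrt G = cfc (x ↦ (√x)⁻¹) G`, the inverse square root `G^{-1/2}` of a positive definite
  Hermitian matrix: `invSqrt_mul_self_mul_invSqrt : G^{-1/2} G G^{-1/2} = 1`,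
  `conjTranspose_invSqrt`, `invSqrt_commute`;
* spectrum bounds from Loewner bounds and back (`le_of_mem_spectrum_of_smul_one_le`, …) and the
  TWO-SIDED LOEWNER CONTROL of `G^{-1/2}` for a nearly-identity Gram matrix,
  `(1-ε)·1 ≤ G ≤ (1+ε)·1`, `0 ≤ ε < 1` ⟹ `(√(1+ε))⁻¹·1 ≤ G^{-1/2} ≤ (√(1-ε))⁻¹·1` and
  `(G^{-1/2} - 1)ᴴ(G^{-1/2} - 1) ≤ d²·1`, `d = (√(1-ε))⁻¹ - 1 ≤ ε/(1-ε)` (`invSqrt_bounds_of_near_one`,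
  `invSqrt_sub_one_sq_le_of_near_one`, `inv_sqrt_one_sub_sub_one_le`);
* the polar isometry `conjTranspose_mul_polarIsometry : (V G^{-1/2})ᴴ (V G^{-1/2}) = 1` and its
  family form `sum_conjTranspose_mul_orthonormalize : Σ_s (A_s G^{-1/2})ᴴ (A_s G^{-1/2}) = 1`;
* a Loewner toolkit for propagating two-sided bounds `-ξ·1 ≤ X ≤ ξ·1` through congruences
  (Horn–Johnson Thm. 7.7.2 (a)): `conj_le_conj`, `sum_conj_le_sum_conj` (Kraus maps are monotone),
  `conj_le_smul_one`, the POLARISATION bound `Pᴴ X Q + Qᴴ X P ≤ 2ξpq·1` (`polarization_le_smul_one`)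
  and the congruence-perturbation bound `(1+D)ᴴ X (1+D) - X ≤ ξ d (2+d)·1` (`conj_sub_self_le`);
* the max-row-sum (Geršgorin / `‖·‖_∞`) Loewner bound for a Hermitian matrix,
  `Σ_j ‖E i j‖ ≤ ε` for all `i` ⟹ `-ε·1 ≤ E ≤ ε·1` (`le_smul_one_of_rowSum_le`,
  `neg_smul_one_le_of_rowSum_le`; Horn–Johnson Thm. 5.6.9 / Cor. 6.1.5, here proved directly
  by the Schur test on the quadratic form).

Motivation (not formalised here): a numerically produced frame — e.g. a matrix-product-state tensor
stored in dyadic rationals — is only NEARLY isometric; the lemmas above produce an EXACTLY isometric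
frame nearby with explicit Loewner-order control computable in exact arithmetic from the stored
data (max row sums), which is what turns a certificate checked on the stored data into a statement
about an exact isometry.

## References
* R. A. Horn, C. R. Johnson, *Matrix Analysis*, 2nd ed., Cambridge University Press (2013):
  Thm. 7.3.1 (polar decomposition; (c) `U = V (VᴴV)^{-1/2}` has orthonormal columns), §7.7
  (Loewner partial order; Thm. 7.7.2 (a): `*`-congruence preserves `⪰`), Thm. 5.6.9 with
  Cor. 6.1.5 (`ρ(A) ≤ ‖A‖_∞ = max_i Σ_j |a_ij|`, the max-row-sum norm of Example 5.6.5).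
  Held: `lit read book:horn2012-matrix-analysis` (PDF pp. 552–553 Thm. 7.3.1; p. 605 Thm. 7.7.2;
  p. 438 Thm. 5.6.9; p. 486 Cor. 6.1.5).
  [cite: HornJohnson2013, Thm. 7.3.1(c), Thm. 7.7.2(a), Thm. 5.6.9, Cor. 6.1.5]
* N. J. Higham, *Functions of Matrices: Theory and Computation*, SIAM (2008), Ch. 6 (matrix square
  root, `A^{-1/2}`) and Ch. 8 (polar decomposition, `U = A (A^*A)^{-1/2}`). [cite: Higham2008, Ch. 6, Ch. 8]
* P.-O. Löwdin, J. Chem. Phys. 18 (1950) 365 (symmetric orthonormalisation `S^{-1/2}`). [folklore]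

## Mathlib
`cfc`, `cfc_mul`, `cfc_id'`, `cfc_one`, `cfc_sub`, `cfc_const_one`, `cfc_congr`,
`cfc_le_algebraMap`, `algebraMap_le_cfc`, `algebraMap_le_iff_le_spectrum`,
`le_algebraMap_iff_spectrum_le`, `cfc_predicate`, `Commute.cfc_real` (for `A = Matrix n n 𝕜`,
`R = ℝ`, predicate `IsSelfAdjoint`); `Matrix.PosSemidef.conjTranspose_mul_mul_same`,
`Matrix.PosSemidef.smul`, `Matrix.le_iff`, `Matrix.IsHermitian.im_star_dotProduct_mulVec_self`.
-/

noncomputable section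

open scoped MatrixOrder ComplexOrder
open Matrix

namespace Literature.LinearAlgebra.Matrix

namespace PolarOrthonormalization

variable {𝕜 : Type*} [RCLike 𝕜]

/-! ### Real scalars in the Loewner order -/

section Scalars

variable {m n : Type*} [Fintype m] [Fintype n] [DecidableEq n]

/-- `algebraMap ℝ (M_n(𝕜)) r = r·1` with the scalar written in `𝕜`. [folklore] -/
private theorem algebraMap_real_eq_smul_one (r : ℝ) :
    algebraMap ℝ (Matrix n n 𝕜) r = (r : 𝕜) • (1 : Matrix n n 𝕜) := by
  rw [Algebra.algebraMap_eq_smul_one, RCLike.real_smul_eq_coe_smul (K := 𝕜)]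

omit [Fintype n] in
/-- `r·1` is Hermitian for real `r`. [folklore] -/
private theorem smul_one_isHermitian (r : ℝ) : ((r : 𝕜) • (1 : Matrix n n 𝕜)).IsHermitian := by
  unfold Matrix.IsHermitian
  rw [conjTranspose_smul, conjTranspose_one, RCLike.star_def, RCLike.conj_ofReal]

omit [Fintype n] in
/-- A Loewner lower bound `c·1 ≤ G` makes `G` Hermitian. [cite: HornJohnson2013, §7.7] -/
theorem isHermitian_of_smul_one_le {G : Matrix n n 𝕜} {c : ℝ}
    (h : (c : 𝕜) • (1 : Matrix n n 𝕜) ≤ G) : G.IsHermitian := by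
  rw [Matrix.le_iff] at h
  have h1 : (G - (c : 𝕜) • (1 : Matrix n n 𝕜)).IsHermitian := h.1
  simpa using h1.add (smul_one_isHermitian (𝕜 := 𝕜) (n := n) c)

omit [Fintype n] in
/-- A Loewner upper bound `G ≤ d·1` makes `G` Hermitian. [cite: HornJohnson2013, §7.7] -/
theorem isHermitian_of_le_smul_one {G : Matrix n n 𝕜} {d : ℝ}
    (h : G ≤ (d : 𝕜) • (1 : Matrix n n 𝕜)) : G.IsHermitian := by
  rw [Matrix.le_iff] at h
  have h1 : ((d : 𝕜) • (1 : Matrix n n 𝕜) - G).IsHermitian := h.1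
  simpa using (smul_one_isHermitian (𝕜 := 𝕜) (n := n) d).sub h1

omit [Fintype n] [DecidableEq n] in
/-- Nonnegative real scaling is monotone in the Loewner order. [cite: HornJohnson2013, §7.7] -/
theorem smul_le_smul_of_le {X Y : Matrix n n 𝕜} (h : X ≤ Y) {c : ℝ} (hc : 0 ≤ c) :
    (c : 𝕜) • X ≤ (c : 𝕜) • Y := by
  rw [Matrix.le_iff] at h ⊢
  rw [← smul_sub]
  exact h.smul (RCLike.ofReal_nonneg.mpr hc)

omit [Fintype n] in
/-- `X ≤ ξ·1`, `0 ≤ c` ⟹ `c·X ≤ (c ξ)·1`. [cite: HornJohnson2013, §7.7] -/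
theorem smul_le_smul_one {X : Matrix n n 𝕜} {ξ c : ℝ} (h : X ≤ (ξ : 𝕜) • (1 : Matrix n n 𝕜))
    (hc : 0 ≤ c) : (c : 𝕜) • X ≤ ((c * ξ : ℝ) : 𝕜) • (1 : Matrix n n 𝕜) := by
  have := smul_le_smul_of_le h hc
  rwa [smul_smul, ← RCLike.ofReal_mul] at this

omit [Fintype n] in
/-- Monotonicity of `r ↦ r·1` in the Loewner order. [cite: HornJohnson2013, §7.7] -/
theorem smul_one_le_smul_one {a b : ℝ} (h : a ≤ b) :
    (a : 𝕜) • (1 : Matrix n n 𝕜) ≤ (b : 𝕜) • (1 : Matrix n n 𝕜) := by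
  rw [Matrix.le_iff, ← sub_smul, ← RCLike.ofReal_sub]
  exact PosSemidef.one.smul (RCLike.ofReal_nonneg.mpr (sub_nonneg.mpr h))

end Scalars

/-! ### Spectrum bounds from Loewner bounds, and back -/

section Spectrum

variable {n : Type*} [Fintype n] [DecidableEq n]

/-- `c·1 ≤ G` forces the (real) spectrum of `G` into `[c, ∞)`. [cite: HornJohnson2013, §7.7] -/
theorem le_of_mem_spectrum_of_smul_one_le {G : Matrix n n 𝕜} {c : ℝ}
    (h : (c : 𝕜) • (1 : Matrix n n 𝕜) ≤ G) : ∀ x ∈ spectrum ℝ G, c ≤ x := by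
  have hsa : IsSelfAdjoint G := (isHermitian_of_smul_one_le h).isSelfAdjoint
  rw [← algebraMap_real_eq_smul_one] at h
  exact (algebraMap_le_iff_le_spectrum (R := ℝ) (a := G)).mp h

/-- `G ≤ d·1` forces the (real) spectrum of `G` into `(-∞, d]`. [cite: HornJohnson2013, §7.7] -/
theorem le_of_mem_spectrum_of_le_smul_one {G : Matrix n n 𝕜} {d : ℝ}
    (h : G ≤ (d : 𝕜) • (1 : Matrix n n 𝕜)) : ∀ x ∈ spectrum ℝ G, x ≤ d := by
  have hsa : IsSelfAdjoint G := (isHermitian_of_le_smul_one h).isSelfAdjoint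
  rw [← algebraMap_real_eq_smul_one] at h
  exact (le_algebraMap_iff_spectrum_le (R := ℝ) (a := G)).mp h

/-- Conversely, a Hermitian matrix with spectrum in `[c, ∞)` satisfies `c·1 ≤ G`.
[cite: HornJohnson2013, §7.7] -/
theorem smul_one_le_of_forall_mem_spectrum {G : Matrix n n 𝕜} (hG : G.IsHermitian) {c : ℝ}
    (h : ∀ x ∈ spectrum ℝ G, c ≤ x) : (c : 𝕜) • (1 : Matrix n n 𝕜) ≤ G := by
  have hsa : IsSelfAdjoint G := hG.isSelfAdjoint
  rw [← algebraMap_real_eq_smul_one]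
  exact (algebraMap_le_iff_le_spectrum (R := ℝ) (a := G)).mpr h

/-- Conversely, a Hermitian matrix with spectrum in `(-∞, d]` satisfies `G ≤ d·1`.
[cite: HornJohnson2013, §7.7] -/
theorem le_smul_one_of_forall_mem_spectrum {G : Matrix n n 𝕜} (hG : G.IsHermitian) {d : ℝ}
    (h : ∀ x ∈ spectrum ℝ G, x ≤ d) : G ≤ (d : 𝕜) • (1 : Matrix n n 𝕜) := by
  have hsa : IsSelfAdjoint G := hG.isSelfAdjoint
  rw [← algebraMap_real_eq_smul_one]
  exact (le_algebraMap_iff_spectrum_le (R := ℝ) (a := G)).mpr h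

end Spectrum

/-! ### The max-row-sum (Geršgorin) Loewner bound -/

section RowSum

variable {n : Type*} [Fintype n] [DecidableEq n]

omit [DecidableEq n] in
/-- `Re ⟨x, x⟩ = Σ ‖x_i‖²`. [folklore] -/
private theorem re_star_dotProduct_self (x : n → 𝕜) : RCLike.re (star x ⬝ᵥ x) = ∑ i, ‖x i‖ ^ 2 := by
  simp only [dotProduct, Pi.star_apply, map_sum]
  refine Finset.sum_congr rfl fun i _ => ?_
  rw [RCLike.star_def, RCLike.conj_mul]
  norm_cast

omit [DecidableEq n] in
/-- `Re ⟨x, E x⟩ ≤ Σ_{ij} ‖E_ij‖ ‖x_i‖ ‖x_j‖`. [folklore] -/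
private theorem re_star_dotProduct_mulVec_le (E : Matrix n n 𝕜) (x : n → 𝕜) :
    RCLike.re (star x ⬝ᵥ (E *ᵥ x)) ≤ ∑ i, ∑ j, ‖E i j‖ * (‖x i‖ * ‖x j‖) := by
  simp only [dotProduct, mulVec, Pi.star_apply, Finset.mul_sum, map_sum]
  refine Finset.sum_le_sum fun i _ => Finset.sum_le_sum fun j _ => ?_
  calc RCLike.re (star (x i) * (E i j * x j)) ≤ ‖star (x i) * (E i j * x j)‖ := RCLike.re_le_norm _
    _ = ‖E i j‖ * (‖x i‖ * ‖x j‖) := by rw [norm_mul, norm_mul, norm_star]; ring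

omit [DecidableEq n] in
/-- The Schur-test / Geršgorin estimate: for Hermitian `E` with all row absolute sums `≤ ε`,
`Σ_{ij} ‖E_ij‖ ‖x_i‖ ‖x_j‖ ≤ ε Σ ‖x_i‖²`. [cite: HornJohnson2013, Cor. 6.1.5] -/
theorem sum_sum_norm_mul_le {E : Matrix n n 𝕜} (hE : E.IsHermitian) {ε : ℝ}
    (h : ∀ i, ∑ j, ‖E i j‖ ≤ ε) (x : n → 𝕜) :
    ∑ i, ∑ j, ‖E i j‖ * (‖x i‖ * ‖x j‖) ≤ ε * ∑ i, ‖x i‖ ^ 2 := by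
  have hsymm : ∀ i j, ‖E j i‖ = ‖E i j‖ := fun i j => by
    rw [← hE.apply i j, norm_star]
  have hT1 : ∑ i, ∑ j, ‖E i j‖ * ‖x i‖ ^ 2 ≤ ε * ∑ i, ‖x i‖ ^ 2 := by
    rw [Finset.mul_sum]
    refine Finset.sum_le_sum fun i _ => ?_
    rw [← Finset.sum_mul]
    exact mul_le_mul_of_nonneg_right (h i) (sq_nonneg _)
  have hT2 : ∑ i, ∑ j, ‖E i j‖ * ‖x j‖ ^ 2 ≤ ε * ∑ i, ‖x i‖ ^ 2 := by
    rw [Finset.sum_comm, Finset.mul_sum]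
    refine Finset.sum_le_sum fun j _ => ?_
    rw [← Finset.sum_mul]
    refine mul_le_mul_of_nonneg_right ?_ (sq_nonneg _)
    calc ∑ i, ‖E i j‖ = ∑ i, ‖E j i‖ := Finset.sum_congr rfl fun i _ => hsymm j i
      _ ≤ ε := h j
  have hAM : ∀ i j, ‖E i j‖ * (‖x i‖ * ‖x j‖) ≤
      ‖E i j‖ * ‖x i‖ ^ 2 / 2 + ‖E i j‖ * ‖x j‖ ^ 2 / 2 := by
    intro i j
    have h0 := norm_nonneg (E i j)
    nlinarith [sq_nonneg (‖x i‖ - ‖x j‖)]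
  calc ∑ i, ∑ j, ‖E i j‖ * (‖x i‖ * ‖x j‖)
      ≤ ∑ i, ∑ j, (‖E i j‖ * ‖x i‖ ^ 2 / 2 + ‖E i j‖ * ‖x j‖ ^ 2 / 2) :=
        Finset.sum_le_sum fun i _ => Finset.sum_le_sum fun j _ => hAM i j
    _ = (∑ i, ∑ j, ‖E i j‖ * ‖x i‖ ^ 2) / 2 + (∑ i, ∑ j, ‖E i j‖ * ‖x j‖ ^ 2) / 2 := by
        simp only [Finset.sum_add_distrib, Finset.sum_div]
    _ ≤ ε * ∑ i, ‖x i‖ ^ 2 := by linarith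

/-- **Max-row-sum Loewner bound.** A Hermitian `E` all of whose row absolute sums are `≤ ε`
satisfies `E ≤ ε·1` (`ρ(E) ≤ ‖E‖_∞`). [cite: HornJohnson2013, Cor. 6.1.5] -/
theorem le_smul_one_of_rowSum_le {E : Matrix n n 𝕜} (hE : E.IsHermitian) {ε : ℝ}
    (h : ∀ i, ∑ j, ‖E i j‖ ≤ ε) : E ≤ (ε : 𝕜) • (1 : Matrix n n 𝕜) := by
  rw [Matrix.le_iff]
  have hM : ((ε : 𝕜) • (1 : Matrix n n 𝕜) - E).IsHermitian := (smul_one_isHermitian ε).sub hE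
  refine PosSemidef.of_dotProduct_mulVec_nonneg hM fun x => ?_
  rw [RCLike.nonneg_iff]
  refine ⟨?_, hM.im_star_dotProduct_mulVec_self x⟩
  rw [sub_mulVec, smul_mulVec, one_mulVec, dotProduct_sub, dotProduct_smul, smul_eq_mul,
    map_sub, RCLike.re_ofReal_mul, re_star_dotProduct_self, sub_nonneg]
  exact (re_star_dotProduct_mulVec_le E x).trans (sum_sum_norm_mul_le hE h x)

/-- **Max-row-sum Loewner bound**, lower side: `-ε·1 ≤ E`. [cite: HornJohnson2013, Cor. 6.1.5] -/
theorem neg_smul_one_le_of_rowSum_le {E : Matrix n n 𝕜} (hE : E.IsHermitian) {ε : ℝ}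
    (h : ∀ i, ∑ j, ‖E i j‖ ≤ ε) : -((ε : 𝕜) • (1 : Matrix n n 𝕜)) ≤ E := by
  have h' : ∀ i, ∑ j, ‖(-E) i j‖ ≤ ε := fun i => by simpa only [Matrix.neg_apply, norm_neg] using h i
  have := le_smul_one_of_rowSum_le hE.neg h'
  exact neg_le.mp this

/-- Two-sided packaging for a Gram matrix: `Σ_j ‖(G - 1) i j‖ ≤ ε` for all `i` (with `G`
Hermitian) gives `(1-ε)·1 ≤ G ≤ (1+ε)·1`. [cite: HornJohnson2013, Cor. 6.1.5] -/
theorem near_one_of_rowSum_le {G : Matrix n n 𝕜} (hG : G.IsHermitian) {ε : ℝ}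
    (h : ∀ i, ∑ j, ‖(G - 1) i j‖ ≤ ε) :
    ((1 - ε : ℝ) : 𝕜) • (1 : Matrix n n 𝕜) ≤ G ∧ G ≤ ((1 + ε : ℝ) : 𝕜) • (1 : Matrix n n 𝕜) := by
  have hE : (G - 1).IsHermitian := hG.sub isHermitian_one
  have h1 := le_smul_one_of_rowSum_le hE h
  have h2 := neg_smul_one_le_of_rowSum_le hE h
  constructor
  · have := le_sub_iff_add_le.mp h2
    rw [RCLike.ofReal_sub, RCLike.ofReal_one, sub_smul, one_smul, ← neg_add_eq_sub]
    exact this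
  · have := sub_le_iff_le_add.mp h1
    rw [RCLike.ofReal_add, RCLike.ofReal_one, add_smul, one_smul, add_comm]
    exact this

end RowSum

/-! ### The inverse square root of a positive definite Hermitian matrix -/

section InvSqrt

variable {n : Type*} [Fintype n] [DecidableEq n]

/-- `G^{-1/2} := cfc (x ↦ (√x)⁻¹) G`, the inverse square root of a Hermitian matrix with positive
spectrum, through the continuous functional calculus (junk value `0` off the self-adjoint
elements). [cite: Higham2008, Ch. 6] -/
def invSqrt (G : Matrix n n 𝕜) : Matrix n n 𝕜 := cfc (fun x : ℝ => (Real.sqrt x)⁻¹) G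

/-- `x ↦ (√x)⁻¹` is continuous on any set of positive reals. [folklore] -/
private theorem continuousOn_inv_sqrt {s : Set ℝ} (hs : ∀ x ∈ s, 0 < x) :
    ContinuousOn (fun x : ℝ => (Real.sqrt x)⁻¹) s :=
  ContinuousOn.inv₀ Real.continuous_sqrt.continuousOn fun x hx => (Real.sqrt_pos.mpr (hs x hx)).ne'

/-- `G^{-1/2}` is self-adjoint. [cite: Higham2008, Ch. 6] -/
theorem isSelfAdjoint_invSqrt (G : Matrix n n 𝕜) : IsSelfAdjoint (invSqrt G) :=
  cfc_predicate _ G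

/-- `G^{-1/2}` is Hermitian. [cite: Higham2008, Ch. 6] -/
theorem isHermitian_invSqrt (G : Matrix n n 𝕜) : (invSqrt G).IsHermitian :=
  (isSelfAdjoint_invSqrt G).isHermitian

/-- `(G^{-1/2})ᴴ = G^{-1/2}`. [cite: Higham2008, Ch. 6] -/
theorem conjTranspose_invSqrt (G : Matrix n n 𝕜) : (invSqrt G)ᴴ = invSqrt G :=
  (isHermitian_invSqrt G).eq

/-- Over `ℝ`: `(G^{-1/2})ᵀ = G^{-1/2}`. [cite: Higham2008, Ch. 6] -/
theorem transpose_invSqrt (G : Matrix n n ℝ) : (invSqrt G)ᵀ = invSqrt G := by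
  have h := conjTranspose_invSqrt G
  rwa [conjTranspose_eq_transpose_of_trivial] at h

/-- `G^{-1/2}` commutes with `G`. [cite: Higham2008, Ch. 6] -/
theorem invSqrt_commute (G : Matrix n n 𝕜) : Commute (invSqrt G) G :=
  Commute.cfc_real (Commute.refl G) _

/-- **`G^{-1/2} · G · G^{-1/2} = 1`** for a Hermitian `G` with positive spectrum.
[cite: HornJohnson2013, Thm. 7.3.1(c)] -/
theorem invSqrt_mul_self_mul_invSqrt {G : Matrix n n 𝕜} (hG : G.IsHermitian)
    (hpos : ∀ x ∈ spectrum ℝ G, 0 < x) : invSqrt G * G * invSqrt G = 1 := by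
  have hsa : IsSelfAdjoint G := hG.isSelfAdjoint
  have hc := continuousOn_inv_sqrt hpos
  unfold invSqrt
  have h1 : cfc (fun x : ℝ => (Real.sqrt x)⁻¹) G * G =
      cfc (fun x : ℝ => (Real.sqrt x)⁻¹ * x) G := by
    nth_rw 2 [← cfc_id' ℝ G]
    rw [← cfc_mul _ _ G hc]
  rw [h1, ← cfc_mul _ _ G _ hc, ← cfc_one ℝ G]
  · apply cfc_congr
    intro x hx
    have hx' := hpos x hx
    have hs : Real.sqrt x ≠ 0 := (Real.sqrt_pos.mpr hx').ne'
    simp only [Pi.one_apply]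
    field_simp
    rw [Real.sq_sqrt hx'.le]
  · exact hc.mul continuousOn_id

/-- `G^{-1/2} G^{-1/2} G = 1` (so `G^{-1/2} G^{-1/2} = G⁻¹`). [cite: Higham2008, Ch. 6] -/
theorem invSqrt_mul_invSqrt_mul_self {G : Matrix n n 𝕜} (hG : G.IsHermitian)
    (hpos : ∀ x ∈ spectrum ℝ G, 0 < x) : invSqrt G * invSqrt G * G = 1 := by
  rw [Matrix.mul_assoc, (invSqrt_commute G).eq, ← Matrix.mul_assoc]
  exact invSqrt_mul_self_mul_invSqrt hG hpos

/-- Upper Loewner bound: spectrum of `G` in `[a, ∞)`, `a > 0` ⟹ `G^{-1/2} ≤ (√a)⁻¹·1`.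
[cite: Higham2008, Ch. 6] -/
theorem invSqrt_le_smul_one {G : Matrix n n 𝕜} (hG : G.IsHermitian) {a : ℝ} (ha : 0 < a)
    (h : ∀ x ∈ spectrum ℝ G, a ≤ x) :
    invSqrt G ≤ (((Real.sqrt a)⁻¹ : ℝ) : 𝕜) • (1 : Matrix n n 𝕜) := by
  have hsa : IsSelfAdjoint G := hG.isSelfAdjoint
  have hpos : ∀ x ∈ spectrum ℝ G, 0 < x := fun x hx => lt_of_lt_of_le ha (h x hx)
  have hc := continuousOn_inv_sqrt hpos
  rw [← algebraMap_real_eq_smul_one]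
  unfold invSqrt
  refine cfc_le_algebraMap _ _ G (fun x hx => ?_) hc
  exact inv_anti₀ (Real.sqrt_pos.mpr ha) (Real.sqrt_le_sqrt (h x hx))

/-- Lower Loewner bound: spectrum of `G` in `[a, b]`, `a > 0` ⟹ `(√b)⁻¹·1 ≤ G^{-1/2}`.
[cite: Higham2008, Ch. 6] -/
theorem smul_one_le_invSqrt {G : Matrix n n 𝕜} (hG : G.IsHermitian) {a b : ℝ} (ha : 0 < a)
    (h : ∀ x ∈ spectrum ℝ G, a ≤ x ∧ x ≤ b) :
    (((Real.sqrt b)⁻¹ : ℝ) : 𝕜) • (1 : Matrix n n 𝕜) ≤ invSqrt G := by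
  have hsa : IsSelfAdjoint G := hG.isSelfAdjoint
  have hpos : ∀ x ∈ spectrum ℝ G, 0 < x := fun x hx => lt_of_lt_of_le ha (h x hx).1
  have hc := continuousOn_inv_sqrt hpos
  rw [← algebraMap_real_eq_smul_one]
  unfold invSqrt
  refine algebraMap_le_cfc _ _ G (fun x hx => ?_) hc
  exact inv_anti₀ (Real.sqrt_pos.mpr (hpos x hx)) (Real.sqrt_le_sqrt (h x hx).2)

/-- The squared deviation of `G^{-1/2}` from `1`: if `((√x)⁻¹ - 1)² ≤ δ²` on the spectrum then
`(G^{-1/2} - 1)(G^{-1/2} - 1) ≤ δ²·1`. [cite: Higham2008, Ch. 6] -/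
theorem invSqrt_sub_one_sq_le {G : Matrix n n 𝕜} (hG : G.IsHermitian)
    (hpos : ∀ x ∈ spectrum ℝ G, 0 < x) {δ : ℝ}
    (h : ∀ x ∈ spectrum ℝ G, ((Real.sqrt x)⁻¹ - 1) ^ 2 ≤ δ ^ 2) :
    (invSqrt G - 1) * (invSqrt G - 1) ≤ ((δ ^ 2 : ℝ) : 𝕜) • (1 : Matrix n n 𝕜) := by
  have hsa : IsSelfAdjoint G := hG.isSelfAdjoint
  have hc := continuousOn_inv_sqrt hpos
  have hc1 : ContinuousOn (fun x : ℝ => (Real.sqrt x)⁻¹ - 1) (spectrum ℝ G) :=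
    hc.sub continuousOn_const
  have hsub : invSqrt G - 1 = cfc (fun x : ℝ => (Real.sqrt x)⁻¹ - 1) G := by
    unfold invSqrt
    rw [cfc_sub _ _ G hc continuousOn_const, cfc_const_one ℝ G]
  rw [hsub, ← cfc_mul _ _ G hc1 hc1, ← algebraMap_real_eq_smul_one]
  refine cfc_le_algebraMap _ _ G (fun x hx => ?_) (hc1.mul hc1)
  rw [← pow_two]
  exact h x hx

/-- The same with `ᴴ`: `(G^{-1/2} - 1)ᴴ (G^{-1/2} - 1) ≤ δ²·1`. [cite: Higham2008, Ch. 6] -/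
theorem conjTranspose_invSqrt_sub_one_mul_self_le {G : Matrix n n 𝕜} (hG : G.IsHermitian)
    (hpos : ∀ x ∈ spectrum ℝ G, 0 < x) {δ : ℝ}
    (h : ∀ x ∈ spectrum ℝ G, ((Real.sqrt x)⁻¹ - 1) ^ 2 ≤ δ ^ 2) :
    (invSqrt G - 1)ᴴ * (invSqrt G - 1) ≤ ((δ ^ 2 : ℝ) : 𝕜) • (1 : Matrix n n 𝕜) := by
  rw [conjTranspose_sub, conjTranspose_invSqrt, conjTranspose_one]
  exact invSqrt_sub_one_sq_le hG hpos h

/-! #### Scalar facts about `x ↦ (√x)⁻¹` near `1` -/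

/-- For `0 ≤ ε < 1` and `x ∈ [1-ε, 1+ε]`: `((√x)⁻¹ - 1)² ≤ ((√(1-ε))⁻¹ - 1)²` (the function is
decreasing, and `1 - (√(1+ε))⁻¹ ≤ (√(1-ε))⁻¹ - 1` by `√(1-ε) √(1+ε) ≤ 1`). [folklore] -/
private theorem inv_sqrt_sub_one_sq_le {ε x : ℝ} (hε0 : 0 ≤ ε) (hε1 : ε < 1)
    (hx : 1 - ε ≤ x ∧ x ≤ 1 + ε) :
    ((Real.sqrt x)⁻¹ - 1) ^ 2 ≤ ((Real.sqrt (1 - ε))⁻¹ - 1) ^ 2 := by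
  have h1ε : 0 < 1 - ε := by linarith
  have hxpos : 0 < x := lt_of_lt_of_le h1ε hx.1
  set s := Real.sqrt x with hs
  set u := Real.sqrt (1 - ε) with hu
  set w := Real.sqrt (1 + ε) with hw
  have hs0 : 0 < s := Real.sqrt_pos.mpr hxpos
  have hu0 : 0 < u := Real.sqrt_pos.mpr h1ε
  have hw0 : 0 < w := Real.sqrt_pos.mpr (by linarith)
  have hus : u ≤ s := Real.sqrt_le_sqrt hx.1
  have hsw : s ≤ w := Real.sqrt_le_sqrt hx.2
  have hu1 : u ≤ 1 := by
    have := Real.sqrt_le_sqrt (show 1 - ε ≤ 1 by linarith)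
    rwa [Real.sqrt_one] at this
  have hu2 : u ^ 2 = 1 - ε := by rw [hu, Real.sq_sqrt h1ε.le]
  have hw2 : w ^ 2 = 1 + ε := by rw [hw, Real.sq_sqrt (by linarith)]
  have huw : u * w ≤ 1 := by nlinarith [sq_nonneg (u - w)]
  have hup : s⁻¹ - 1 ≤ u⁻¹ - 1 := by
    have := inv_anti₀ hu0 hus
    linarith
  have hlow : -(u⁻¹ - 1) ≤ s⁻¹ - 1 := by
    have h1 : w⁻¹ ≤ s⁻¹ := inv_anti₀ hs0 hsw
    have h2 : 2 ≤ u⁻¹ + w⁻¹ := by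
      have hprod : 1 ≤ u⁻¹ * w⁻¹ := by
        rw [← mul_inv, one_le_inv_iff₀]
        exact ⟨mul_pos hu0 hw0, huw⟩
      nlinarith [sq_nonneg (u⁻¹ - w⁻¹), inv_pos.mpr hu0, inv_pos.mpr hw0]
    linarith
  have hnonneg : 0 ≤ u⁻¹ - 1 := by
    have := (one_le_inv_iff₀.mpr ⟨hu0, hu1⟩)
    linarith
  nlinarith [hup, hlow, hnonneg]

/-- `0 ≤ (√(1-ε))⁻¹ - 1` for `0 ≤ ε < 1`. [folklore] -/
private theorem inv_sqrt_one_sub_sub_one_nonneg {ε : ℝ} (hε0 : 0 ≤ ε) (hε1 : ε < 1) :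
    0 ≤ (Real.sqrt (1 - ε))⁻¹ - 1 := by
  have h1ε : 0 < 1 - ε := by linarith
  have hu0 : 0 < Real.sqrt (1 - ε) := Real.sqrt_pos.mpr h1ε
  have hu1 : Real.sqrt (1 - ε) ≤ 1 := by
    have := Real.sqrt_le_sqrt (show 1 - ε ≤ 1 by linarith)
    rwa [Real.sqrt_one] at this
  have := (one_le_inv_iff₀.mpr ⟨hu0, hu1⟩)
  linarith

/-- `(√(1-ε))⁻¹ ≤ (1-ε)⁻¹` for `0 ≤ ε < 1`, whence `d := (√(1-ε))⁻¹ - 1 ≤ ε/(1-ε)` and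
`1 + d ≤ (1-ε)⁻¹`. [folklore] -/
private theorem inv_sqrt_one_sub_le {ε : ℝ} (hε0 : 0 ≤ ε) (hε1 : ε < 1) :
    (Real.sqrt (1 - ε))⁻¹ ≤ (1 - ε)⁻¹ := by
  have h1ε : 0 < 1 - ε := by linarith
  have hu0 : 0 < Real.sqrt (1 - ε) := Real.sqrt_pos.mpr h1ε
  refine inv_anti₀ h1ε ?_
  -- `1 - ε ≤ √(1-ε)` since `1 - ε ≤ 1`
  have hle : (1 - ε) ≤ 1 := by linarith
  calc 1 - ε = Real.sqrt (1 - ε) * Real.sqrt (1 - ε) := (Real.mul_self_sqrt h1ε.le).symm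
    _ ≤ Real.sqrt (1 - ε) * 1 := by
        refine mul_le_mul_of_nonneg_left ?_ hu0.le
        have := Real.sqrt_le_sqrt hle
        rwa [Real.sqrt_one] at this
    _ = Real.sqrt (1 - ε) := mul_one _

/-- `d = (√(1-ε))⁻¹ - 1 ≤ ε/(1-ε)`. [folklore] -/
private theorem inv_sqrt_one_sub_sub_one_le {ε : ℝ} (hε0 : 0 ≤ ε) (hε1 : ε < 1) :
    (Real.sqrt (1 - ε))⁻¹ - 1 ≤ ε / (1 - ε) := by
  have h1ε : 0 < 1 - ε := by linarith
  have h := inv_sqrt_one_sub_le hε0 hε1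
  have : ε / (1 - ε) = (1 - ε)⁻¹ - 1 := by
    field_simp
    ring
  rw [this]
  linarith

/-- **Two-sided control of `G^{-1/2}` for a nearly-identity Gram matrix.** If
`(1-ε)·1 ≤ G ≤ (1+ε)·1` with `0 ≤ ε < 1` then `(√(1+ε))⁻¹·1 ≤ G^{-1/2} ≤ (√(1-ε))⁻¹·1`.
[cite: Higham2008, Ch. 6] [cite: HornJohnson2013, §7.7] -/
theorem invSqrt_bounds_of_near_one {G : Matrix n n 𝕜} {ε : ℝ} (hε1 : ε < 1)
    (hlo : ((1 - ε : ℝ) : 𝕜) • (1 : Matrix n n 𝕜) ≤ G)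
    (hhi : G ≤ ((1 + ε : ℝ) : 𝕜) • (1 : Matrix n n 𝕜)) :
    (((Real.sqrt (1 + ε))⁻¹ : ℝ) : 𝕜) • (1 : Matrix n n 𝕜) ≤ invSqrt G ∧
      invSqrt G ≤ (((Real.sqrt (1 - ε))⁻¹ : ℝ) : 𝕜) • (1 : Matrix n n 𝕜) := by
  have hG : G.IsHermitian := isHermitian_of_smul_one_le hlo
  have h1ε : 0 < 1 - ε := by linarith
  have hspec : ∀ x ∈ spectrum ℝ G, 1 - ε ≤ x ∧ x ≤ 1 + ε := fun x hx =>
    ⟨le_of_mem_spectrum_of_smul_one_le hlo x hx, le_of_mem_spectrum_of_le_smul_one hhi x hx⟩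
  exact ⟨smul_one_le_invSqrt hG h1ε hspec, invSqrt_le_smul_one hG h1ε fun x hx => (hspec x hx).1⟩

/-- **Deviation of `G^{-1/2}` from `1` for a nearly-identity Gram matrix**:
`(1-ε)·1 ≤ G ≤ (1+ε)·1`, `0 ≤ ε < 1` ⟹ `(G^{-1/2} - 1)ᴴ (G^{-1/2} - 1) ≤ d²·1` with
`d = (√(1-ε))⁻¹ - 1`. [cite: Higham2008, Ch. 6] [cite: HornJohnson2013, §7.7] -/
theorem invSqrt_sub_one_sq_le_of_near_one {G : Matrix n n 𝕜} {ε : ℝ} (hε0 : 0 ≤ ε) (hε1 : ε < 1)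
    (hlo : ((1 - ε : ℝ) : 𝕜) • (1 : Matrix n n 𝕜) ≤ G)
    (hhi : G ≤ ((1 + ε : ℝ) : 𝕜) • (1 : Matrix n n 𝕜)) :
    (invSqrt G - 1)ᴴ * (invSqrt G - 1) ≤
      ((((Real.sqrt (1 - ε))⁻¹ - 1) ^ 2 : ℝ) : 𝕜) • (1 : Matrix n n 𝕜) := by
  have hG : G.IsHermitian := isHermitian_of_smul_one_le hlo
  have h1ε : 0 < 1 - ε := by linarith
  have hspec : ∀ x ∈ spectrum ℝ G, 1 - ε ≤ x ∧ x ≤ 1 + ε := fun x hx =>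
    ⟨le_of_mem_spectrum_of_smul_one_le hlo x hx, le_of_mem_spectrum_of_le_smul_one hhi x hx⟩
  have hpos : ∀ x ∈ spectrum ℝ G, 0 < x := fun x hx => lt_of_lt_of_le h1ε (hspec x hx).1
  exact conjTranspose_invSqrt_sub_one_mul_self_le hG hpos fun x hx =>
    inv_sqrt_sub_one_sq_le hε0 hε1 (hspec x hx)

/-- Positivity of the spectrum of a nearly-identity Gram matrix. [folklore] -/
private theorem spectrum_pos_of_near_one {G : Matrix n n 𝕜} {ε : ℝ} (hε1 : ε < 1)
    (hlo : ((1 - ε : ℝ) : 𝕜) • (1 : Matrix n n 𝕜) ≤ G) : ∀ x ∈ spectrum ℝ G, 0 < x :=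
  fun x hx => lt_of_lt_of_le (by linarith) (le_of_mem_spectrum_of_smul_one_le hlo x hx)

/-- **Rational control of `G^{-1/2}`** (the constants of a perturbation analysis in exact
arithmetic): `(1-ε)·1 ≤ G ≤ (1+ε)·1`, `0 ≤ ε < 1` ⟹ `G^{-1/2} ≤ (1-ε)⁻¹·1` (since
`(1-ε)^{-1/2} ≤ (1-ε)^{-1}`). [cite: Higham2008, Ch. 6] [cite: HornJohnson2013, §7.7] -/
theorem invSqrt_le_smul_one_of_near_one {G : Matrix n n 𝕜} {ε : ℝ} (hε0 : 0 ≤ ε) (hε1 : ε < 1)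
    (hlo : ((1 - ε : ℝ) : 𝕜) • (1 : Matrix n n 𝕜) ≤ G)
    (hhi : G ≤ ((1 + ε : ℝ) : 𝕜) • (1 : Matrix n n 𝕜)) :
    invSqrt G ≤ (((1 - ε)⁻¹ : ℝ) : 𝕜) • (1 : Matrix n n 𝕜) :=
  (invSqrt_bounds_of_near_one hε1 hlo hhi).2.trans (smul_one_le_smul_one (inv_sqrt_one_sub_le hε0 hε1))

/-- **Rational control of `G^{-1/2} - 1`**: `(1-ε)·1 ≤ G ≤ (1+ε)·1`, `0 ≤ ε < 1` ⟹
`(G^{-1/2} - 1)ᴴ (G^{-1/2} - 1) ≤ (ε/(1-ε))²·1` (since `(1-ε)^{-1/2} - 1 ≤ (1-ε)^{-1} - 1 = ε/(1-ε)`).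
[cite: Higham2008, Ch. 6] [cite: HornJohnson2013, §7.7] -/
theorem invSqrt_sub_one_sq_le_of_near_one' {G : Matrix n n 𝕜} {ε : ℝ} (hε0 : 0 ≤ ε) (hε1 : ε < 1)
    (hlo : ((1 - ε : ℝ) : 𝕜) • (1 : Matrix n n 𝕜) ≤ G)
    (hhi : G ≤ ((1 + ε : ℝ) : 𝕜) • (1 : Matrix n n 𝕜)) :
    (invSqrt G - 1)ᴴ * (invSqrt G - 1) ≤ (((ε / (1 - ε)) ^ 2 : ℝ) : 𝕜) • (1 : Matrix n n 𝕜) := by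
  refine (invSqrt_sub_one_sq_le_of_near_one hε0 hε1 hlo hhi).trans (smul_one_le_smul_one ?_)
  have h0 := inv_sqrt_one_sub_sub_one_nonneg hε0 hε1
  have h1 := inv_sqrt_one_sub_sub_one_le hε0 hε1
  nlinarith

end InvSqrt

/-! ### The polar isometry (Löwdin symmetric orthonormalisation) -/

section Polar

variable {m n : Type*} [Fintype m] [Fintype n] [DecidableEq n]

/-- **Polar isometry** (Horn–Johnson Thm. 7.3.1 (c)): for `V` whose Gram matrix `VᴴV` has positive
spectrum, `U := V (VᴴV)^{-1/2}` has orthonormal columns, `UᴴU = 1`.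
[cite: HornJohnson2013, Thm. 7.3.1(c)] -/
theorem conjTranspose_mul_polarIsometry (V : Matrix m n 𝕜)
    (hpos : ∀ x ∈ spectrum ℝ (Vᴴ * V), 0 < x) :
    (V * invSqrt (Vᴴ * V))ᴴ * (V * invSqrt (Vᴴ * V)) = 1 := by
  have hG : (Vᴴ * V).IsHermitian := isHermitian_conjTranspose_mul_self V
  rw [conjTranspose_mul, conjTranspose_invSqrt, Matrix.mul_assoc, ← Matrix.mul_assoc Vᴴ,
    ← Matrix.mul_assoc]
  exact invSqrt_mul_self_mul_invSqrt hG hpos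

/-- **Symmetric orthonormalisation of a family**: with `G = Σ_s A_sᴴ A_s` of positive spectrum,
`Ã_s := A_s G^{-1/2}` satisfies `Σ_s Ã_sᴴ Ã_s = 1` exactly. [cite: HornJohnson2013, Thm. 7.3.1(c)] -/
theorem sum_conjTranspose_mul_orthonormalize {ι : Type*} [Fintype ι] (A : ι → Matrix n n 𝕜)
    (hpos : ∀ x ∈ spectrum ℝ (∑ s, (A s)ᴴ * A s), 0 < x) :
    ∑ s, (A s * invSqrt (∑ s, (A s)ᴴ * A s))ᴴ * (A s * invSqrt (∑ s, (A s)ᴴ * A s)) = 1 := by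
  set G := ∑ s, (A s)ᴴ * A s with hGdef
  have hG : G.IsHermitian := by
    rw [hGdef]
    exact isSelfAdjoint_sum Finset.univ fun s _ => isHermitian_conjTranspose_mul_self (A s)
  have hterm : ∀ s, (A s * invSqrt G)ᴴ * (A s * invSqrt G) =
      invSqrt G * ((A s)ᴴ * A s) * invSqrt G := by
    intro s
    rw [conjTranspose_mul, conjTranspose_invSqrt]
    simp only [Matrix.mul_assoc]
  simp_rw [hterm]
  rw [← Finset.sum_mul, ← Finset.mul_sum]
  exact invSqrt_mul_self_mul_invSqrt hG hpos

/-- Polar isometry from a Loewner lower bound on the Gram matrix: `(1-ε)·1 ≤ VᴴV`, `ε < 1` ⟹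
`(V (VᴴV)^{-1/2})ᴴ (V (VᴴV)^{-1/2}) = 1`. [cite: HornJohnson2013, Thm. 7.3.1(c)] -/
theorem conjTranspose_mul_polarIsometry_of_near_one (V : Matrix m n 𝕜) {ε : ℝ} (hε1 : ε < 1)
    (hlo : ((1 - ε : ℝ) : 𝕜) • (1 : Matrix n n 𝕜) ≤ Vᴴ * V) :
    (V * invSqrt (Vᴴ * V))ᴴ * (V * invSqrt (Vᴴ * V)) = 1 :=
  conjTranspose_mul_polarIsometry V (spectrum_pos_of_near_one hε1 hlo)

/-- Symmetric orthonormalisation of a nearly isometric family: `(1-ε)·1 ≤ Σ_s A_sᴴ A_s`, `ε < 1`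
⟹ `Σ_s (A_s G^{-1/2})ᴴ (A_s G^{-1/2}) = 1`, `G = Σ_s A_sᴴ A_s`. [cite: HornJohnson2013, Thm. 7.3.1(c)] -/
theorem sum_conjTranspose_mul_orthonormalize_of_near_one {ι : Type*} [Fintype ι]
    (A : ι → Matrix n n 𝕜) {ε : ℝ} (hε1 : ε < 1)
    (hlo : ((1 - ε : ℝ) : 𝕜) • (1 : Matrix n n 𝕜) ≤ ∑ s, (A s)ᴴ * A s) :
    ∑ s, (A s * invSqrt (∑ s, (A s)ᴴ * A s))ᴴ * (A s * invSqrt (∑ s, (A s)ᴴ * A s)) = 1 :=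
  sum_conjTranspose_mul_orthonormalize A (spectrum_pos_of_near_one hε1 hlo)

end Polar

/-! ### A Loewner toolkit for congruences -/

section Loewner

variable {m n : Type*} [Fintype m] [Fintype n] [DecidableEq m] [DecidableEq n]

omit [DecidableEq m] [DecidableEq n] in
/-- `*`-congruence preserves the Loewner order: `X ≤ Y ⟹ Mᴴ X M ≤ Mᴴ Y M` (rectangular `M`).
[cite: HornJohnson2013, Thm. 7.7.2(a)] -/
theorem conj_le_conj {X Y : Matrix m m 𝕜} (h : X ≤ Y) (M : Matrix m n 𝕜) :
    Mᴴ * X * M ≤ Mᴴ * Y * M := by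
  rw [Matrix.le_iff] at h ⊢
  have := h.conjTranspose_mul_mul_same M
  convert this using 1
  simp [Matrix.mul_sub, Matrix.sub_mul]

omit [DecidableEq m] [DecidableEq n] in
/-- Kraus (completely positive) maps are monotone: `X ≤ Y ⟹ Σ_s A_sᴴ X A_s ≤ Σ_s A_sᴴ Y A_s`.
[cite: HornJohnson2013, Thm. 7.7.2(a)] -/
theorem sum_conj_le_sum_conj {ι : Type*} [Fintype ι] {X Y : Matrix m m 𝕜} (h : X ≤ Y)
    (A : ι → Matrix m n 𝕜) : ∑ s, (A s)ᴴ * X * A s ≤ ∑ s, (A s)ᴴ * Y * A s :=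
  Finset.sum_le_sum fun s _ => conj_le_conj h (A s)

omit [DecidableEq m] [DecidableEq n] in
/-- `Mᴴ M` is Loewner-nonnegative. [folklore] -/
private theorem conjTranspose_mul_self_nonneg' (M : Matrix m n 𝕜) : 0 ≤ Mᴴ * M := by
  rw [Matrix.nonneg_iff_posSemidef]
  exact posSemidef_conjTranspose_mul_self M

/-- `X ≤ ξ·1`, `MᴴM ≤ μ·1`, `0 ≤ ξ` ⟹ `Mᴴ X M ≤ (ξ μ)·1`. [cite: HornJohnson2013, Thm. 7.7.2(a)] -/
theorem conj_le_smul_one {X : Matrix m m 𝕜} {ξ μ : ℝ} (hξ : 0 ≤ ξ)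
    (hX : X ≤ (ξ : 𝕜) • (1 : Matrix m m 𝕜)) (M : Matrix m n 𝕜)
    (hM : Mᴴ * M ≤ (μ : 𝕜) • (1 : Matrix n n 𝕜)) :
    Mᴴ * X * M ≤ ((ξ * μ : ℝ) : 𝕜) • (1 : Matrix n n 𝕜) := by
  have h1 : Mᴴ * X * M ≤ Mᴴ * ((ξ : 𝕜) • (1 : Matrix m m 𝕜)) * M := conj_le_conj hX M
  rw [Matrix.mul_smul, Matrix.mul_one, Matrix.smul_mul] at h1
  exact h1.trans (smul_le_smul_one hM hξ)

/-- `-ξ·1 ≤ X`, `MᴴM ≤ μ·1`, `0 ≤ ξ` ⟹ `-(ξ μ)·1 ≤ Mᴴ X M`. [cite: HornJohnson2013, Thm. 7.7.2(a)] -/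
theorem neg_smul_one_le_conj {X : Matrix m m 𝕜} {ξ μ : ℝ} (hξ : 0 ≤ ξ)
    (hX : -((ξ : 𝕜) • (1 : Matrix m m 𝕜)) ≤ X) (M : Matrix m n 𝕜)
    (hM : Mᴴ * M ≤ (μ : 𝕜) • (1 : Matrix n n 𝕜)) :
    -(((ξ * μ : ℝ) : 𝕜) • (1 : Matrix n n 𝕜)) ≤ Mᴴ * X * M := by
  have hX' : -X ≤ (ξ : 𝕜) • (1 : Matrix m m 𝕜) := neg_le.mp hX
  have h := conj_le_smul_one hξ hX' M hM
  rw [Matrix.mul_neg, Matrix.neg_mul] at h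
  exact neg_le.mp h

omit [DecidableEq n] in
/-- **Polarisation** (unweighted): `-ξ·1 ≤ X ≤ ξ·1` ⟹ `Pᴴ X Q + Qᴴ X P ≤ ξ·(PᴴP + QᴴQ)`, from
`(P+Q)ᴴ(ξ·1 - X)(P+Q) ⪰ 0` and `(P-Q)ᴴ(ξ·1 + X)(P-Q) ⪰ 0`. [cite: HornJohnson2013, Thm. 7.7.2(a)] -/
theorem polarization_le {X : Matrix m m 𝕜} {ξ : ℝ} (hX₁ : X ≤ (ξ : 𝕜) • (1 : Matrix m m 𝕜))
    (hX₂ : -((ξ : 𝕜) • (1 : Matrix m m 𝕜)) ≤ X) (P Q : Matrix m n 𝕜) :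
    Pᴴ * X * Q + Qᴴ * X * P ≤ (ξ : 𝕜) • (Pᴴ * P + Qᴴ * Q) := by
  -- the two congruences
  have h1 : (P + Q)ᴴ * X * (P + Q) ≤ (P + Q)ᴴ * ((ξ : 𝕜) • (1 : Matrix m m 𝕜)) * (P + Q) :=
    conj_le_conj hX₁ (P + Q)
  have h2 : (P - Q)ᴴ * (-((ξ : 𝕜) • (1 : Matrix m m 𝕜))) * (P - Q) ≤ (P - Q)ᴴ * X * (P - Q) :=
    conj_le_conj hX₂ (P - Q)
  have h3 := sub_le_sub h1 h2
  -- `h3 : (P+Q)ᴴX(P+Q) - (P-Q)ᴴX(P-Q) ≤ ξ (P+Q)ᴴ(P+Q) + ξ (P-Q)ᴴ(P-Q)`; both sides are twice ours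
  have hL : (P + Q)ᴴ * X * (P + Q) - (P - Q)ᴴ * X * (P - Q) =
      (2 : 𝕜) • (Pᴴ * X * Q + Qᴴ * X * P) := by
    simp only [conjTranspose_add, conjTranspose_sub, Matrix.add_mul, Matrix.mul_add,
      Matrix.sub_mul, Matrix.mul_sub, two_smul]
    abel
  have hR : (P + Q)ᴴ * ((ξ : 𝕜) • (1 : Matrix m m 𝕜)) * (P + Q) -
      (P - Q)ᴴ * (-((ξ : 𝕜) • (1 : Matrix m m 𝕜))) * (P - Q) =
      (2 : 𝕜) • ((ξ : 𝕜) • (Pᴴ * P + Qᴴ * Q)) := by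
    simp only [conjTranspose_add, conjTranspose_sub, Matrix.mul_neg, Matrix.neg_mul,
      Matrix.mul_smul, Matrix.smul_mul, Matrix.mul_one, Matrix.add_mul, Matrix.mul_add,
      Matrix.sub_mul, Matrix.mul_sub, smul_add, smul_sub, two_smul, sub_neg_eq_add]
    abel
  rw [hL, hR] at h3
  -- divide by two
  have h4 := smul_le_smul_of_le h3 (c := (2⁻¹ : ℝ)) (by norm_num)
  have h22 : ((2⁻¹ : ℝ) : 𝕜) * (2 : 𝕜) = 1 := by
    rw [RCLike.ofReal_inv, RCLike.ofReal_ofNat]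
    exact inv_mul_cancel₀ two_ne_zero
  rwa [smul_smul, smul_smul, h22, one_smul, one_smul] at h4

/-- **Polarisation bound** (weighted, optimised): `-ξ·1 ≤ X ≤ ξ·1`, `PᴴP ≤ p²·1`, `QᴴQ ≤ q²·1`
with `ξ, p, q ≥ 0` ⟹ `Pᴴ X Q + Qᴴ X P ≤ 2ξpq·1` (the Loewner form of `‖PᴴXQ + QᴴXP‖ ≤ 2‖X‖‖P‖‖Q‖`).
[cite: HornJohnson2013, Thm. 7.7.2(a)] -/
theorem polarization_le_smul_one {X : Matrix m m 𝕜} {ξ p q : ℝ} (hξ : 0 ≤ ξ) (hp : 0 ≤ p)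
    (hq : 0 ≤ q) (hX₁ : X ≤ (ξ : 𝕜) • (1 : Matrix m m 𝕜))
    (hX₂ : -((ξ : 𝕜) • (1 : Matrix m m 𝕜)) ≤ X) {P Q : Matrix m n 𝕜}
    (hP : Pᴴ * P ≤ ((p ^ 2 : ℝ) : 𝕜) • (1 : Matrix n n 𝕜))
    (hQ : Qᴴ * Q ≤ ((q ^ 2 : ℝ) : 𝕜) • (1 : Matrix n n 𝕜)) :
    Pᴴ * X * Q + Qᴴ * X * P ≤ ((2 * ξ * p * q : ℝ) : 𝕜) • (1 : Matrix n n 𝕜) := by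
  -- degenerate cases: `p = 0` forces `P = 0`, `q = 0` forces `Q = 0`
  have hzero : ∀ {R : Matrix m n 𝕜} {r : ℝ}, Rᴴ * R ≤ ((r ^ 2 : ℝ) : 𝕜) • (1 : Matrix n n 𝕜) →
      r = 0 → R = 0 := by
    intro R r hR hr
    rw [hr, sq, mul_zero, RCLike.ofReal_zero, zero_smul] at hR
    have h0 : Rᴴ * R = 0 := le_antisymm hR (conjTranspose_mul_self_nonneg' R)
    exact conjTranspose_mul_self_eq_zero.mp h0
  rcases hp.eq_or_lt with hp0 | hp0
  · have hP0 : P = 0 := hzero hP hp0.symm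
    rw [hP0, ← hp0]
    simp
  rcases hq.eq_or_lt with hq0 | hq0
  · have hQ0 : Q = 0 := hzero hQ hq0.symm
    rw [hQ0, ← hq0]
    simp
  -- weights: `c² = q/p`
  set c : ℝ := Real.sqrt (q / p) with hc
  have hc0 : 0 < c := Real.sqrt_pos.mpr (div_pos hq0 hp0)
  have hc2 : c ^ 2 = q / p := Real.sq_sqrt (div_pos hq0 hp0).le
  have hcc : (c : 𝕜) * ((c⁻¹ : ℝ) : 𝕜) = 1 := by
    rw [← RCLike.ofReal_mul, mul_inv_cancel₀ hc0.ne', RCLike.ofReal_one]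
  have hcc' : ((c⁻¹ : ℝ) : 𝕜) * (c : 𝕜) = 1 := by rw [mul_comm, hcc]
  set P' : Matrix m n 𝕜 := (c : 𝕜) • P with hP'
  set Q' : Matrix m n 𝕜 := ((c⁻¹ : ℝ) : 𝕜) • Q with hQ'
  have hstar : ∀ r : ℝ, star ((r : ℝ) : 𝕜) = (r : 𝕜) := fun r => by
    rw [RCLike.star_def, RCLike.conj_ofReal]
  have hLHS : P'ᴴ * X * Q' + Q'ᴴ * X * P' = Pᴴ * X * Q + Qᴴ * X * P := by
    simp only [hP', hQ', conjTranspose_smul, hstar, Matrix.smul_mul, Matrix.mul_smul, smul_smul,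
      hcc, hcc', one_smul]
  have hP'le : P'ᴴ * P' ≤ ((c ^ 2 * p ^ 2 : ℝ) : 𝕜) • (1 : Matrix n n 𝕜) := by
    have : P'ᴴ * P' = ((c ^ 2 : ℝ) : 𝕜) • (Pᴴ * P) := by
      simp only [hP', conjTranspose_smul, hstar, Matrix.smul_mul, Matrix.mul_smul, smul_smul,
        ← RCLike.ofReal_mul, sq]
    rw [this]
    exact smul_le_smul_one hP (sq_nonneg c)
  have hQ'le : Q'ᴴ * Q' ≤ ((c⁻¹ ^ 2 * q ^ 2 : ℝ) : 𝕜) • (1 : Matrix n n 𝕜) := by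
    have : Q'ᴴ * Q' = ((c⁻¹ ^ 2 : ℝ) : 𝕜) • (Qᴴ * Q) := by
      simp only [hQ', conjTranspose_smul, hstar, Matrix.smul_mul, Matrix.mul_smul, smul_smul,
        ← RCLike.ofReal_mul, sq]
    rw [this]
    exact smul_le_smul_one hQ (sq_nonneg c⁻¹)
  have hpol := polarization_le hX₁ hX₂ P' Q'
  rw [hLHS] at hpol
  refine hpol.trans ?_
  have hsum : P'ᴴ * P' + Q'ᴴ * Q' ≤ ((c ^ 2 * p ^ 2 + c⁻¹ ^ 2 * q ^ 2 : ℝ) : 𝕜) • (1 : Matrix n n 𝕜) := by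
    have := add_le_add hP'le hQ'le
    rwa [← add_smul, ← RCLike.ofReal_add] at this
  refine (smul_le_smul_one hsum hξ).trans (smul_one_le_smul_one (le_of_eq ?_))
  -- `ξ (c²p² + c⁻²q²) = 2 ξ p q` with `c² = q/p`
  have hc2' : c⁻¹ ^ 2 = p / q := by rw [inv_pow, hc2, inv_div]
  rw [hc2, hc2']
  field_simp
  ring

/-- Lower polarisation bound: `-(2ξpq)·1 ≤ Pᴴ X Q + Qᴴ X P`. [cite: HornJohnson2013, Thm. 7.7.2(a)] -/
theorem neg_smul_one_le_polarization {X : Matrix m m 𝕜} {ξ p q : ℝ} (hξ : 0 ≤ ξ) (hp : 0 ≤ p)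
    (hq : 0 ≤ q) (hX₁ : X ≤ (ξ : 𝕜) • (1 : Matrix m m 𝕜))
    (hX₂ : -((ξ : 𝕜) • (1 : Matrix m m 𝕜)) ≤ X) {P Q : Matrix m n 𝕜}
    (hP : Pᴴ * P ≤ ((p ^ 2 : ℝ) : 𝕜) • (1 : Matrix n n 𝕜))
    (hQ : Qᴴ * Q ≤ ((q ^ 2 : ℝ) : 𝕜) • (1 : Matrix n n 𝕜)) :
    -(((2 * ξ * p * q : ℝ) : 𝕜) • (1 : Matrix n n 𝕜)) ≤ Pᴴ * X * Q + Qᴴ * X * P := by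
  have hX₁' : -X ≤ (ξ : 𝕜) • (1 : Matrix m m 𝕜) := neg_le.mp hX₂
  have hX₂' : -((ξ : 𝕜) • (1 : Matrix m m 𝕜)) ≤ -X := neg_le_neg hX₁
  have h := polarization_le_smul_one hξ hp hq hX₁' hX₂' hP hQ
  rw [Matrix.mul_neg, Matrix.mul_neg, Matrix.neg_mul, Matrix.neg_mul, ← neg_add] at h
  exact neg_le.mp h

/-- **Congruence perturbation**: `-ξ·1 ≤ X ≤ ξ·1`, `DᴴD ≤ d²·1`, `ξ, d ≥ 0` ⟹
`(1+D)ᴴ X (1+D) - X ≤ ξ d (2+d)·1` (Loewner form of `‖SXS - X‖ ≤ ‖X‖ ‖S-1‖ (‖S‖+1)`, `S = 1+D`).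
[cite: HornJohnson2013, Thm. 7.7.2(a)] -/
theorem conj_sub_self_le {X D : Matrix n n 𝕜} {ξ d : ℝ} (hξ : 0 ≤ ξ) (hd : 0 ≤ d)
    (hX₁ : X ≤ (ξ : 𝕜) • (1 : Matrix n n 𝕜)) (hX₂ : -((ξ : 𝕜) • (1 : Matrix n n 𝕜)) ≤ X)
    (hD : Dᴴ * D ≤ ((d ^ 2 : ℝ) : 𝕜) • (1 : Matrix n n 𝕜)) :
    (1 + D)ᴴ * X * (1 + D) - X ≤ ((ξ * d * (2 + d) : ℝ) : 𝕜) • (1 : Matrix n n 𝕜) := by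
  have hone : (1 : Matrix n n 𝕜)ᴴ * 1 ≤ ((1 ^ 2 : ℝ) : 𝕜) • (1 : Matrix n n 𝕜) := by
    rw [conjTranspose_one, Matrix.mul_one, one_pow, RCLike.ofReal_one, one_smul]
  have hcross := polarization_le_smul_one hξ hd zero_le_one hX₁ hX₂ hD hone
  have hdiag : Dᴴ * X * D ≤ ((ξ * d ^ 2 : ℝ) : 𝕜) • (1 : Matrix n n 𝕜) := conj_le_smul_one hξ hX₁ D hD
  have hsplit : (1 + D)ᴴ * X * (1 + D) - X = (Dᴴ * X * 1 + (1 : Matrix n n 𝕜)ᴴ * X * D) + Dᴴ * X * D := by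
    simp only [conjTranspose_add, conjTranspose_one, Matrix.add_mul, Matrix.mul_add, Matrix.one_mul,
      Matrix.mul_one]
    abel
  rw [hsplit]
  have := add_le_add hcross hdiag
  refine this.trans ?_
  rw [← add_smul, ← RCLike.ofReal_add]
  exact smul_one_le_smul_one (le_of_eq (by ring))

/-- **Congruence perturbation**, lower side: `-(ξ d (2+d))·1 ≤ (1+D)ᴴ X (1+D) - X`.
[cite: HornJohnson2013, Thm. 7.7.2(a)] -/
theorem neg_smul_one_le_conj_sub_self {X D : Matrix n n 𝕜} {ξ d : ℝ} (hξ : 0 ≤ ξ) (hd : 0 ≤ d)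
    (hX₁ : X ≤ (ξ : 𝕜) • (1 : Matrix n n 𝕜)) (hX₂ : -((ξ : 𝕜) • (1 : Matrix n n 𝕜)) ≤ X)
    (hD : Dᴴ * D ≤ ((d ^ 2 : ℝ) : 𝕜) • (1 : Matrix n n 𝕜)) :
    -(((ξ * d * (2 + d) : ℝ) : 𝕜) • (1 : Matrix n n 𝕜)) ≤ (1 + D)ᴴ * X * (1 + D) - X := by
  have hX₁' : -X ≤ (ξ : 𝕜) • (1 : Matrix n n 𝕜) := neg_le.mp hX₂
  have hX₂' : -((ξ : 𝕜) • (1 : Matrix n n 𝕜)) ≤ -X := neg_le_neg hX₁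
  have h := conj_sub_self_le hξ hd hX₁' hX₂' hD
  rw [Matrix.mul_neg, Matrix.neg_mul, sub_neg_eq_add, neg_add_eq_sub, ← neg_sub] at h
  exact neg_le.mp h

omit [Fintype m] [DecidableEq m] [Fintype n] in
/-- `X ≤ ξ·1` and `-ξ·1 ≤ X` imply `0 ≤ ξ` as soon as the index type is nonempty.
[cite: HornJohnson2013, §7.7] -/
theorem nonneg_of_abs_le [Nonempty n] {X : Matrix n n 𝕜} {ξ : ℝ}
    (hX₁ : X ≤ (ξ : 𝕜) • (1 : Matrix n n 𝕜)) (hX₂ : -((ξ : 𝕜) • (1 : Matrix n n 𝕜)) ≤ X) :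
    0 ≤ ξ := by
  have h := hX₂.trans hX₁
  -- `-ξ·1 ≤ ξ·1` gives `0 ≤ 2ξ·1`, whose diagonal entry is `2ξ ≥ 0`
  rw [Matrix.le_iff, sub_neg_eq_add, ← add_smul, ← RCLike.ofReal_add] at h
  obtain ⟨i⟩ := ‹Nonempty n›
  have hd := h.diag_nonneg (i := i)
  rw [Matrix.smul_apply, one_apply_eq, smul_eq_mul, mul_one, RCLike.ofReal_nonneg] at hd
  linarith

end Loewner

end PolarOrthonormalization

end Literature.LinearAlgebra.Matrix

end
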